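import Literature.IUT.HodgeArakelov.PlusMinusTowerCoverModelAPI
import Literature.IUT.HodgeArakelov.PlusMinusTowerCoverModelCompletionV
import Literature.AnabelianGeometry.SemiGraphs.TemperedCompletionOpenSubgroups
import HarnessLib

/-!
# [IUTchII] Def 2.3 (i) at the genuine tower: `Π^cor_v ∩ Π̂_v = Π_v` and `Π^cor_v ∩ Π̂^±_v = Π^±_v` (tempered vs. profinite closure)

S. Mochizuki, *Inter-universal Teichmüller Theory II*, kurims manuscript (Dec. 2020), §2, Def 2.3 (i) p. 67 (the six groups
`Π_v ⊆ Π^±_v ⊆ Π^cor_v`, `Π̂_v ⊆ Π̂^±_v ⊆ Π̂^cor_v`, «`∧` denotes the profinite completion»); Cor 2.4 (i) proof p. 71 l. 3–5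
(«`Δ^±_{v□} = Δ̂^±_{v□} ∩ Δ^±_v`»-type intersections of tempered groups with profinite closures) [cite: Mochizuki2012, II Def 2.3 (i) p.67]
(D-0012 claim key, status DISPUTED — elementary bookkeeping over the typed interfaces; nothing of the series is asserted);
*Semi-graphs of anabelioids*, Publ. RIMS **42** (2006), §6 p. 69 («natural injections `Π^temp ↪ Π`»; an open subgroup of finite index is
closed in the profinite topology) [cite: MochizukiSemiAnbd2006, §6 p.69].

abc-iut cell, node **IUTchII:Cor2.4(i)** (CONE-BOARD claimant abc-iut-w4-d012; gen 6).  PROOF-ONLY (no `def`/`instance`/`structure`).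
For abc-iut-L6-t19's genuine `±`-tower `PlusMinusTower.ofCoverModel` (B14, p430122; parametric in an injective profinite completion
`ι : Π^tp_C → Q`) and the tower of record `ofPiCHat`, the TOWER-PLACEMENT binder
`hinf : W.piPM ⊓ W.hat ≤ W.piV` («`Π^±_v ∩ Π̂_v ⊆ Π_v`») of the level-based (B) reductions of [IUTchII] Cor 2.4 (i)/(ii)(iii)
(abc-iut-w5-d121: `cor24_i'_of_levels_of_equiv_zHat` p419450, `cor24_i'_of_levels_byName` p420168, `cor24_i'_of_graphLevels_byName`
p420922, `cor24_i'_of_graphTower_byName`; so far witnessed only at abc-iut-w5-d028's cyclic toy, `PlusMinusTowerCyclicToy.piPM_inf_hat_le_piV`)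
is a THEOREM: `Π_v = ι(inclX Π^tp_{X̲̲_v})` is the image of an OPEN subgroup of FINITE INDEX (`2·l²`) of `Π^tp_C`, and for such a subgroup
`U`, `ι⁻¹(cl ι(U)) = U` (abc-iut-w5-d139's `IsProfiniteCompletion.comap_topologicalClosure_map`, [SemiAnbd] §6 p. 69).

* `finiteIndex_map_inclX_Huu` — `inclX(Π^tp_{X̲̲_v}) ≤ Π^tp_C` has finite index (open by abc-iut-L6-t19's B15b `isOpen_map_inclX_Huu`, p437138);
* `cor_inf_hat_ofCoverModel` — **`Π^cor_v ∩ Π̂_v = Π_v`**; `cor_inf_pmHat_ofCoverModel` — **`Π^cor_v ∩ Π̂^±_v = Π^±_v`**;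
* `piPM_inf_hat_le_piV_ofCoverModel` — the binder `hinf` («`Π^±_v ∩ Π̂_v ⊆ Π_v`»), and `piPM_inf_hat_ofCoverModel` (`= Π_v`);
* `cor_inf_hat_ofPiCHat`, `cor_inf_pmHat_ofPiCHat`, `piPM_inf_hat_le_piV_ofPiCHat` — the tower of record inside abc-iut-L2-d3's `Π_C`.

Binders as in B14 (L02 `hZ`, `hN`).  Nothing here takes a side on [IUTchIII] Cor 3.12; typed ≠ proved.
-/

noncomputable section

namespace Literature.IUT.HodgeArakelov

open Literature.AnabelianGeometry.EtaleTheta Literature.AnabelianGeometry.SemiGraphs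
open scoped Pointwise

namespace PlusMinusTower

variable {p : ℕ} [Fact p.Prime] {M : MuTwoSetting p} (e : M.CLevelData)
  {E : M.toThetaSetting.EtaleThetaData} {l : ℕ} (C : E.DoubleUnderline l) {N : ℕ+}
  (μ : M.toThetaSetting.CyclotomeMod l N) (hC : M.toThetaSetting.Compat) (hS : M.toThetaSetting.Sec2Hyps)
  (hl : l.Prime) (hp2 : p ≠ 2) (hpl : p ≠ l) (hζ : ∃ ζ : M.toThetaSetting.K, IsPrimitiveRoot ζ (4 * l))
  {η : (C.thetaEnvData μ hC hS).PiYdd → MuN p N} (hη : η ∈ (C.thetaEnvData μ hC hS).thetaCocycles)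
  {Q : Type} [Group Q] [TopologicalSpace Q] [IsTopologicalGroup Q]
  (ι : M.GtpC →ₜ* Q) (hι : IsProfiniteCompletion ι) (hinj : Function.Injective ι)
  (Φ : Q →* GQp p) (hΦ : ∀ g : M.GtpC, Φ (ι g) = e.augC g) (hΦK : Φ.range = M.GK)
  (hZ : Thm16Sub.KerToZIsCompactlyGenerated M.toThetaSetting) (hN : (C.Huu.subgroupOf (M.GtpXu l)).Normal)
  {P : TopGroup.{0}} (T : TemperedCoverings (BadPlaceSetting.ofUnderline C μ hC hS hl hp2 hpl hζ hη) P)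

/-- `[Π^tp_C : inclX(Π^tp_{X̲̲_v})] = 2·l²` is finite (`l` odd) — abc-iut-L6-t19's `index_map_inclX_Huu` (B15b). [cite: MochizukiEtTh2009, Def 2.1 p.36] -/
theorem finiteIndex_map_inclX_Huu : (C.Huu.map M.inclX).FiniteIndex :=
  ⟨by rw [index_map_inclX_Huu C]; exact mul_ne_zero two_ne_zero (pow_ne_zero _ C.l_ne_zero)⟩

include hι in
/-- **`Π^cor_v ∩ Π̂_v = Π_v`** for abc-iut-L6-t19's parametric genuine tower `ofCoverModel` ([IUTchII] Def 2.3 (i): `Π̂_v` is the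
closure of `Π_v = ι(inclX Π^tp_{X̲̲_v})` in `Π̂^cor_v = Q`, `Π^cor_v = ι(Π^tp_C)`): an element of `Π^tp_C` whose image lies in the closure
of the image of the open finite-index subgroup `inclX Π^tp_{X̲̲_v}` lies in that subgroup (abc-iut-w5-d139's
`IsProfiniteCompletion.comap_topologicalClosure_map`).  PROVED. ([IUTchII] Def 2.3 (i), kurims p.67) [claim: Mochizuki2012, status: disputed] -/
theorem cor_inf_hat_ofCoverModel :
    (ofCoverModel e C μ hC hS hl hp2 hpl hζ hη ι hι hinj Φ hΦ hΦK hZ hN T).cor ⊓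
        (ofCoverModel e C μ hC hS hl hp2 hpl hζ hη ι hι hinj Φ hΦ hΦK hZ hN T).hat =
      (ofCoverModel e C μ hC hS hl hp2 hpl hζ hη ι hι hinj Φ hΦ hΦK hZ hN T).piV := by
  haveI := finiteIndex_map_inclX_Huu C
  rw [piV_ofCoverModel, (ofCoverModel_fields e C μ hC hS hl hp2 hpl hζ hη ι hι hinj Φ hΦ hΦK hZ hN T).2.1,
    (ofCoverModel_fields e C μ hC hS hl hp2 hpl hζ hη ι hι hinj Φ hΦ hΦK hZ hN T).2.2.2.1]
  apply le_antisymm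
  · rintro y ⟨⟨g, rfl⟩, hy⟩
    have hg : g ∈ (((C.Huu.map M.inclX).map ι.toMonoidHom).topologicalClosure : Subgroup Q).comap ι.toMonoidHom := hy
    rw [IsProfiniteCompletion.comap_topologicalClosure_map hι _ (isOpen_map_inclX_Huu e C)] at hg
    exact ⟨g, hg, rfl⟩
  · rintro _ ⟨g, hg, rfl⟩
    exact ⟨⟨g, rfl⟩, (((C.Huu.map M.inclX).map ι.toMonoidHom : Subgroup Q)).le_topologicalClosure ⟨g, hg, rfl⟩⟩

include hι in
/-- **`Π^cor_v ∩ Π̂^±_v = Π^±_v`** for `ofCoverModel` (`Π̂^±_v` = closure of `Π^±_v = ι(inclX Π^tp_{X̲_v})`, an open subgroup of index `2l`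
of `Π^tp_C`, abc-iut-L6-t19 `index_map_inclX_GtpXu`).  PROVED. ([IUTchII] Def 2.3 (i), kurims p.67) [claim: Mochizuki2012, status: disputed] -/
theorem cor_inf_pmHat_ofCoverModel :
    (ofCoverModel e C μ hC hS hl hp2 hpl hζ hη ι hι hinj Φ hΦ hΦK hZ hN T).cor ⊓
        (ofCoverModel e C μ hC hS hl hp2 hpl hζ hη ι hι hinj Φ hΦ hΦK hZ hN T).pmHat =
      (ofCoverModel e C μ hC hS hl hp2 hpl hζ hη ι hι hinj Φ hΦ hΦK hZ hN T).piPM := by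
  haveI : ((M.GtpXu l).map M.inclX).FiniteIndex :=
    ⟨by rw [MuTwoSetting.index_map_inclX_GtpXu l M]; exact mul_ne_zero two_ne_zero C.l_ne_zero⟩
  have hopen : IsOpen (((M.GtpXu l).map M.inclX : Subgroup M.GtpC) : Set M.GtpC) := by
    rw [Subgroup.coe_map]
    exact e.isOpenEmbedding_inclX.isOpenMap _ (M.toThetaSetting.isOpen_GtpXu l)
  rw [piPM_ofCoverModel, (ofCoverModel_fields e C μ hC hS hl hp2 hpl hζ hη ι hι hinj Φ hΦ hΦK hZ hN T).2.1,
    (ofCoverModel_fields e C μ hC hS hl hp2 hpl hζ hη ι hι hinj Φ hΦ hΦK hZ hN T).2.2.1]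
  apply le_antisymm
  · rintro y ⟨⟨g, rfl⟩, hy⟩
    have hg : g ∈ ((((M.GtpXu l).map M.inclX).map ι.toMonoidHom).topologicalClosure : Subgroup Q).comap ι.toMonoidHom := hy
    rw [IsProfiniteCompletion.comap_topologicalClosure_map hι _ hopen] at hg
    exact ⟨g, hg, rfl⟩
  · rintro _ ⟨g, hg, rfl⟩
    exact ⟨⟨g, rfl⟩, ((((M.GtpXu l).map M.inclX).map ι.toMonoidHom : Subgroup Q)).le_topologicalClosure ⟨g, hg, rfl⟩⟩

include hι in
/-- **`Π^±_v ∩ Π̂_v = Π_v`** for `ofCoverModel` (`Π^±_v ⊆ Π^cor_v`).  PROVED. ([IUTchII] Def 2.3 (i), kurims p.67) [claim: Mochizuki2012, status: disputed] -/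
theorem piPM_inf_hat_ofCoverModel :
    (ofCoverModel e C μ hC hS hl hp2 hpl hζ hη ι hι hinj Φ hΦ hΦK hZ hN T).piPM ⊓
        (ofCoverModel e C μ hC hS hl hp2 hpl hζ hη ι hι hinj Φ hΦ hΦK hZ hN T).hat =
      (ofCoverModel e C μ hC hS hl hp2 hpl hζ hη ι hι hinj Φ hΦ hΦK hZ hN T).piV := by
  apply le_antisymm
  · rw [← cor_inf_hat_ofCoverModel e C μ hC hS hl hp2 hpl hζ hη ι hι hinj Φ hΦ hΦK hZ hN T]
    exact inf_le_inf_right _ (piV_le_piPM_le_cor_ofCoverModel e C μ hC hS hl hp2 hpl hζ hη ι hι hinj Φ hΦ hΦK hZ hN T).2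
  · exact le_inf (piV_le_piPM_le_cor_ofCoverModel e C μ hC hS hl hp2 hpl hζ hη ι hι hinj Φ hΦ hΦK hZ hN T).1
      (ofCoverModel e C μ hC hS hl hp2 hpl hζ hη ι hι hinj Φ hΦ hΦK hZ hN T).embP_le_hat

include hι in
/-- **The binder `hinf` of the level-based (B) reductions of [IUTchII] Cor 2.4 — «`Π^±_v ∩ Π̂_v ⊆ Π_v`» — HOLDS at `ofCoverModel`.**
PROVED. ([IUTchII] Def 2.3 (i), kurims p.67; Cor 2.4 (i) proof p.71) [claim: Mochizuki2012, status: disputed] -/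
theorem piPM_inf_hat_le_piV_ofCoverModel :
    (ofCoverModel e C μ hC hS hl hp2 hpl hζ hη ι hι hinj Φ hΦ hΦK hZ hN T).piPM ⊓
        (ofCoverModel e C μ hC hS hl hp2 hpl hζ hη ι hι hinj Φ hΦ hΦK hZ hN T).hat ≤
      (ofCoverModel e C μ hC hS hl hp2 hpl hζ hη ι hι hinj Φ hΦ hΦK hZ hN T).piV :=
  (piPM_inf_hat_ofCoverModel e C μ hC hS hl hp2 hpl hζ hη ι hι hinj Φ hΦ hΦK hZ hN T).le

/-! ### The tower of record `ofPiCHat` (inside abc-iut-L2-d3's `Π_C`) -/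

/-- **`Π^cor_v ∩ Π̂_v = Π_v`** for the tower of record `ofPiCHat`.  PROVED. ([IUTchII] Def 2.3 (i), kurims p.67) [claim: Mochizuki2012, status: disputed] -/
theorem cor_inf_hat_ofPiCHat :
    (ofPiCHat e C μ hC hS hl hp2 hpl hζ hη hZ hN T).cor ⊓ (ofPiCHat e C μ hC hS hl hp2 hpl hζ hη hZ hN T).hat =
      (ofPiCHat e C μ hC hS hl hp2 hpl hζ hη hZ hN T).piV :=
  cor_inf_hat_ofCoverModel e C μ hC hS hl hp2 hpl hζ hη e.toPiCHat e.isProfiniteCompletion_toPiCHat e.toPiCHat_injective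
    e.piCData.aug.toMonoidHom (fun g => e.piCData_aug_apply g) e.piCData.range_aug hZ hN T

/-- **`Π^cor_v ∩ Π̂^±_v = Π^±_v`** for the tower of record `ofPiCHat`.  PROVED. ([IUTchII] Def 2.3 (i), kurims p.67) [claim: Mochizuki2012, status: disputed] -/
theorem cor_inf_pmHat_ofPiCHat :
    (ofPiCHat e C μ hC hS hl hp2 hpl hζ hη hZ hN T).cor ⊓ (ofPiCHat e C μ hC hS hl hp2 hpl hζ hη hZ hN T).pmHat =
      (ofPiCHat e C μ hC hS hl hp2 hpl hζ hη hZ hN T).piPM :=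
  cor_inf_pmHat_ofCoverModel e C μ hC hS hl hp2 hpl hζ hη e.toPiCHat e.isProfiniteCompletion_toPiCHat e.toPiCHat_injective
    e.piCData.aug.toMonoidHom (fun g => e.piCData_aug_apply g) e.piCData.range_aug hZ hN T

/-- **`Π^±_v ∩ Π̂_v = Π_v`** and the binder **`hinf`** («`Π^±_v ∩ Π̂_v ⊆ Π_v`») for the tower of record `ofPiCHat`.  PROVED.
([IUTchII] Def 2.3 (i), kurims p.67; Cor 2.4 (i) proof p.71) [claim: Mochizuki2012, status: disputed] -/
theorem piPM_inf_hat_le_piV_ofPiCHat :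
    (ofPiCHat e C μ hC hS hl hp2 hpl hζ hη hZ hN T).piPM ⊓ (ofPiCHat e C μ hC hS hl hp2 hpl hζ hη hZ hN T).hat =
        (ofPiCHat e C μ hC hS hl hp2 hpl hζ hη hZ hN T).piV ∧
      (ofPiCHat e C μ hC hS hl hp2 hpl hζ hη hZ hN T).piPM ⊓ (ofPiCHat e C μ hC hS hl hp2 hpl hζ hη hZ hN T).hat ≤
        (ofPiCHat e C μ hC hS hl hp2 hpl hζ hη hZ hN T).piV :=
  ⟨piPM_inf_hat_ofCoverModel e C μ hC hS hl hp2 hpl hζ hη e.toPiCHat e.isProfiniteCompletion_toPiCHat e.toPiCHat_injective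
      e.piCData.aug.toMonoidHom (fun g => e.piCData_aug_apply g) e.piCData.range_aug hZ hN T,
    piPM_inf_hat_le_piV_ofCoverModel e C μ hC hS hl hp2 hpl hζ hη e.toPiCHat e.isProfiniteCompletion_toPiCHat e.toPiCHat_injective
      e.piCData.aug.toMonoidHom (fun g => e.piCData_aug_apply g) e.piCData.range_aug hZ hN T⟩

end PlusMinusTower

end Literature.IUT.HodgeArakelov

end
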